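import Mathlib
import HarnessLib.Audit
import Summits.PneNP.PneNP.Theorems.PstarChordBridgeForcing
import Summits.PneNP.PneNP.Theorems.PstarChordSystemMap

/-!
# The single-read regime theorem for a terminal core, modulo (EXC)/(NOR) analysis (ROUND-24, memo §9 R1–R7, §10 (★★); GAPTWO-PLAN S4d)

FRONTIER range-avoidance ladder, rung F-N3, ROUND 24 (cell `pnp-ideate`, planner memo `r24/CORE-BOUND-NOTES.md` §9 (the chain R1 → R5 → R7) and §10
("SINGLE-READ BASIS (after R5)" and (★★)); restricted-model proof complexity — nothing here bears on `P` versus `NP`).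

This file COMPOSES the chain for an actual terminal core with a forest of non-chords (bridge data `B`, `PstarChordBridge`), in the regime
"no pendant reads a private" (constant reads) and "every two chords are killable at a common base point":

* `q_dir`, `q_dir_add` — after the basis change `toX m` (`PstarChordSystemMap`) the second constraint of the core's chord system is
  `q_m = m₂·(free₁ + b₁) + m₁·(free₂ + b₂)` on the cube, quadratic with polar form `m₂·freePolar₁ + m₁·freePolar₂`;
* `forced_chord_cases_dir` — (★★) + R7 for the basis-changed system: for every direction `m ≠ 0` with all reads on `{0, m}`, every chord-minimal chord
  is (EQ) / (EXC) / (NOR) with respect to `q_m`;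
* `eq_of_U2` — in the (U2) corner only the doubly-read chord is chord-minimal (M-read);
* `regime_cases` — **the packaged regime theorem**: pure typed `(r,3/2)`-expanding instance with simple overlaps, well-formed bridge data with
  `#J₀ ≤ r` and the lift property, no pendant reading a private, pairwise killable chords (memo R4; non-killable pairs are elliptic bundles,
  `PstarChordBridgeCollapse.killable_pair_or_exc`), the terminal system `J₀ ∧ Γ₁ ∧ Γ₂` unsolvable but solvable after deleting any single chord.  Then
  EITHER (U2) `N = {e₀}` is a single chord, read by both constraints independently (the one-chord corner, memo O3), OR there is a direction `m ≠ 0`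
  carrying every read vector such that EVERY chord of `N` is (EQ), (EXC) or (NOR) with respect to `q_m` — and by
  `PstarChordBridgeForcing.chord_eq_of_EQ` at most one of them is (EQ).

What is left for `CoreShape` on this line (memo §10 R7 rows (i′)/(iii), O5): eliminate (EXC) pairs (elliptic bundles of path AND-graphs) and read
the (NOR) flat as a single-literal NOR — then `LitNorStructure` and `PstarLitNorCoreProof.litNorCoreBound` finish.
-/

set_option linter.dupNamespace false -- `Summit.PneNP.PneNP.…`: summit = sub-problem name (D-0017 single-conjunct layout)

open Finset Module Literature.Computability.Complexity
open Summit.PneNP.PneNP.Theorems.PstarFibrePolys (bit)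
open Summit.PneNP.PneNP.Theorems.PstarTyped (Typed)
open Summit.PneNP.PneNP.Theorems.PstarSALevel (varSet bdry BoundaryExpanding SimpleOverlap)
open Summit.PneNP.PneNP.Theorems.PstarCubeIdeals (IsAffineFn)
open Summit.PneNP.PneNP.Theorems.PstarProductRank (qform polar)
open Summit.PneNP.PneNP.Theorems.PstarReadSumset (V2)
open Summit.PneNP.PneNP.Theorems.PstarChordSystem (ChordSystem)
open Summit.PneNP.PneNP.Theorems.PstarChordForcing (forced_chord_cases)
open Summit.PneNP.PneNP.Theorems.PstarChordSystemMap (mapSys toX mapSys_u mapSys_toX_q toX_injective U1_package)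
open Summit.PneNP.PneNP.Theorems.PstarChordBridgeTools
open Summit.PneNP.PneNP.Theorems.PstarChordBridge
open Summit.PneNP.PneNP.Theorems.PstarChordBridgeForcing

namespace Summit.PneNP.PneNP.Theorems.PstarChordBridgeBasis

variable {n m : ℕ}

/-! ## The second constraint after the basis change -/

/-- The second constraint of the core's chord system in direction `mv`: `q_m = m₂·(free₁ + b₁) + m₁·(free₂ + b₂)`. -/
def qDir (I : LocalMap 4 n m) (B : BridgeData n m) (mv : V2) (x : Fin n → ZMod 2) : ZMod 2 :=
  mv.2 * (free I B.y (B.J₀ \ B.N) B.N B.T₁ B.C₁ B.G₁ x + bit B.b₁) + mv.1 * (free I B.y (B.J₀ \ B.N) B.N B.T₂ B.C₂ B.G₂ x + bit B.b₂)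

/-- Its polar form. -/
def polarDir (I : LocalMap 4 n m) (B : BridgeData n m) (mv : V2) : LinearMap.BilinForm (ZMod 2) (Fin n → ZMod 2) :=
  mv.2 • freePolar I B.N B.T₁ B.G₁ + mv.1 • freePolar I B.N B.T₂ B.G₂

/-- **The basis-changed second constraint is `q_m`.** -/
theorem q_dir (I : LocalMap 4 n m) (B : BridgeData n m) (mv : V2) (x : Fin n → ZMod 2) :
    ((mapSys (sys I B) (toX mv)).F x).2 + (mapSys (sys I B) (toX mv)).t.2 = qDir I B mv x := by
  rw [mapSys_toX_q, sys_F, sys_t]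
  rfl

/-- **`q_m` is quadratic** with polar form `polarDir`. -/
theorem q_dir_add (I : LocalMap 4 n m) (B : BridgeData n m) (mv : V2) (x w : Fin n → ZMod 2) :
    ((mapSys (sys I B) (toX mv)).F (x + w)).2 + (mapSys (sys I B) (toX mv)).t.2 =
      (((mapSys (sys I B) (toX mv)).F x).2 + (mapSys (sys I B) (toX mv)).t.2) +
      (((mapSys (sys I B) (toX mv)).F w).2 + (mapSys (sys I B) (toX mv)).t.2) +
      (((mapSys (sys I B) (toX mv)).F 0).2 + (mapSys (sys I B) (toX mv)).t.2) + polarDir I B mv x w := by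
  simp only [q_dir, qDir, polarDir, LinearMap.add_apply, LinearMap.smul_apply, smul_eq_mul, free_add]
  have h3 : ∀ t : ZMod 2, t + t + t = t := by decide
  have e1 := h3 (bit B.b₁)
  have e2 := h3 (bit B.b₂)
  linear_combination (-mv.2) * e1 + (-mv.1) * e2

/-! ## (★★) + R7 in a direction -/

/-- **Forced chords in direction `m`.**  If every read vector of the core's chord system lies on the line `{0, m}` (`m ≠ 0`), the reads are constant,
the system is infeasible and chord-minimal in `e ∈ N` (`#J₀ ≤ r` on a pure `(r,3/2)`-expanding instance with simple overlaps), then with `Q := Q_{D e}`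
and `q := q_m`: (EQ) `Q = q + κ`, or (EXC) `Q = q + ν₁ν₂ + κ`, or (NOR) `Z(q) = {λ₁ = λ₂ = 1}` is a codimension-two flat and
`Q + γ_e + 1 = (λ₁+1)m₁ + (λ₂+1)m₂`. -/
theorem forced_chord_cases_dir (I : LocalMap 4 n m) (hI : I.IsPure xorAndPred) (hS : SimpleOverlap I) {r : ℕ} (hB : BoundaryExpanding r I)
    {B : BridgeData n m} (hW : B.WF I) (hr : B.J₀.card ≤ r) {mv : V2} (hm : mv ≠ 0)
    (hU1 : ∀ e a, ((sys I B).ρ e a = 0 ∨ (sys I B).ρ e a = mv) ∧ ((sys I B).ρ' e a = 0 ∨ (sys I B).ρ' e a = mv))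
    (hconst : ∀ e a a', (sys I B).ρ e a = (sys I B).ρ e a' ∧ (sys I B).ρ' e a = (sys I B).ρ' e a')
    (hinf : (sys I B).Infeasible B.N) {e : Fin m} (he : e ∈ B.N) (hM : (sys I B).ChordMinimal B.N e) :
    (∃ κ : ZMod 2, ∀ x, qform (B.D e) (fun j => I.vars j 2) (fun j => I.vars j 3) x = qDir I B mv x + κ) ∨
    (∃ ν₁ ν₂ : (Fin n → ZMod 2) → ZMod 2, IsAffineFn ν₁ ∧ IsAffineFn ν₂ ∧ ∃ κ : ZMod 2, ∀ x,
      qform (B.D e) (fun j => I.vars j 2) (fun j => I.vars j 3) x = qDir I B mv x + ν₁ x * ν₂ x + κ) ∨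
    (∃ a b : Fin n → ZMod 2, polarDir I B mv a b = 1 ∧
      (∀ x, qDir I B mv x = (polarDir I B mv x b + (qDir I B mv b + qDir I B mv 0)) * (polarDir I B mv x a + (qDir I B mv a + qDir I B mv 0)) + 1) ∧
      ∃ m₁ m₂ : (Fin n → ZMod 2) → ZMod 2, IsAffineFn m₁ ∧ IsAffineFn m₂ ∧
        ∀ x, qform (B.D e) (fun j => I.vars j 2) (fun j => I.vars j 3) x + (gam B e + 1) =
          (polarDir I B mv x b + (qDir I B mv b + qDir I B mv 0) + 1) * m₁ x + (polarDir I B mv x a + (qDir I B mv a + qDir I B mv 0) + 1) * m₂ x) := by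
  obtain ⟨hSR, hinf', hmin', hconst'⟩ := U1_package (sys I B) hinf hm hU1 hconst
  have h := forced_chord_cases (mapSys (sys I B) (toX mv)) hSR hconst' hinf' he (hmin' e hM) (q_dir_add I B mv)
    (Q := qform (B.D e) (fun j => I.vars j 2) (fun j => I.vars j 3)) (γ := gam B e) (fun a => by rw [mapSys_u]; exact sys_u_eq I B e a)
    (qform_add' I (B.D e)) (rank_four_of_wf I hI hS hB hW hr he)
  simp only [q_dir] at h
  exact h

/-! ## The (U2) corner has one chord -/

/-- **In the (U2) corner only the doubly-read chord can be chord-minimal**: a chord whose (constant) read vectors vanish is read nowhere, contradicting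
M-read (`PstarChordSystem.read_of_chordMinimal`). -/
theorem eq_of_U2 (I : LocalMap 4 n m) {B : BridgeData n m}
    (hconst : ∀ e a a', (sys I B).ρ e a = (sys I B).ρ e a' ∧ (sys I B).ρ' e a = (sys I B).ρ' e a') (hinf : (sys I B).Infeasible B.N)
    {e₀ : Fin m} (hU2 : ∀ e ∈ B.N, e ≠ e₀ → (sys I B).ρ e 0 = 0 ∧ (sys I B).ρ' e 0 = 0) {e : Fin m} (he : e ∈ B.N)
    (hM : (sys I B).ChordMinimal B.N e) : e = e₀ := by
  by_contra hne
  obtain ⟨a, -, -, -, hread⟩ := (sys I B).read_of_chordMinimal hinf he hM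
  unfold ChordSystem.Read at hread
  rw [(hconst e a 0).1, (hconst e a 0).2] at hread
  rcases hread with h | h
  · exact h (hU2 e he hne).1
  · exact h (hU2 e he hne).2

/-! ## The packaged regime theorem -/

/-- **Single-read regime for a terminal core, modulo (EXC)/(NOR).**  Pure typed `(r,3/2)`-expanding instance with simple overlaps, well-formed bridge
data with `#J₀ ≤ r` and the lift property, no pendant reading a private, PAIRWISE KILLABLE chords (`PstarChordSystem.direction_collapse`'s hypothesis —
by `PstarChordBridgeCollapse.killable_pair_or_exc` a non-killable pair is an elliptic bundle; the calibration core CONS-P3 has a bundled pair that IS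
killable), the terminal system unsolvable but solvable after deleting any single chord.  Then EITHER (U2) `N = {e₀}` is a single chord read by both
constraints independently (memo O3), OR there is a direction `m ≠ 0` carrying every read vector such that EVERY chord of `N` is (EQ), (EXC) or (NOR)
with respect to `q_m` — and by `PstarChordBridgeForcing.chord_eq_of_EQ` at most one of them is (EQ). -/
theorem regime_cases (I : LocalMap 4 n m) (hI : I.IsPure xorAndPred) (hT : Typed I) (hS : SimpleOverlap I) {r : ℕ}
    (hB : BoundaryExpanding r I) {B : BridgeData n m} (hW : B.WF I) (hr : B.J₀.card ≤ r) (hL : Lift I B)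
    (hun : ∀ v ∈ privs I B.N, (∀ g ∈ B.G₁, I.vars g 2 ≠ v ∧ I.vars g 3 ≠ v) ∧ ∀ g ∈ B.G₂, I.vars g 2 ≠ v ∧ I.vars g 3 ≠ v)
    (hK : ∀ e ∈ B.N, ∀ e' ∈ B.N, e ≠ e' → ∃ a, (sys I B).u e a = 0 ∧ (sys I B).u e' a = 0)
    (hT3 : ¬ ∃ z, Solution I B B.J₀ z) (hM0 : ∀ e ∈ B.N, ∃ z, Solution I B (B.J₀.erase e) z) :
    (∃ e₀, B.N = {e₀} ∧ (sys I B).ρ e₀ 0 ≠ 0 ∧ (sys I B).ρ' e₀ 0 ≠ 0 ∧ (sys I B).ρ e₀ 0 ≠ (sys I B).ρ' e₀ 0) ∨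
    (∃ mv : V2, mv ≠ 0 ∧ (∀ e ∈ B.N, ((sys I B).ρ e 0 = 0 ∨ (sys I B).ρ e 0 = mv) ∧ ((sys I B).ρ' e 0 = 0 ∨ (sys I B).ρ' e 0 = mv)) ∧
      ∀ e ∈ B.N,
        (∃ κ : ZMod 2, ∀ x, qform (B.D e) (fun j => I.vars j 2) (fun j => I.vars j 3) x = qDir I B mv x + κ) ∨
        (∃ ν₁ ν₂ : (Fin n → ZMod 2) → ZMod 2, IsAffineFn ν₁ ∧ IsAffineFn ν₂ ∧ ∃ κ : ZMod 2, ∀ x,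
          qform (B.D e) (fun j => I.vars j 2) (fun j => I.vars j 3) x = qDir I B mv x + ν₁ x * ν₂ x + κ) ∨
        (∃ a b : Fin n → ZMod 2, polarDir I B mv a b = 1 ∧
          (∀ x, qDir I B mv x =
            (polarDir I B mv x b + (qDir I B mv b + qDir I B mv 0)) * (polarDir I B mv x a + (qDir I B mv a + qDir I B mv 0)) + 1) ∧
          ∃ m₁ m₂ : (Fin n → ZMod 2) → ZMod 2, IsAffineFn m₁ ∧ IsAffineFn m₂ ∧
            ∀ x, qform (B.D e) (fun j => I.vars j 2) (fun j => I.vars j 3) x + (gam B e + 1) =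
              (polarDir I B mv x b + (qDir I B mv b + qDir I B mv 0) + 1) * m₁ x +
              (polarDir I B mv x a + (qDir I B mv a + qDir I B mv 0) + 1) * m₂ x)) := by
  have hinf : (sys I B).Infeasible B.N := infeasible_of_not_solution I hI hT hW hL hT3
  have hmin : ∀ e ∈ B.N, (sys I B).ChordMinimal B.N e := fun e he => by
    obtain ⟨z, hz⟩ := hM0 e he
    exact chordMinimal_of_solution_erase I hI hT hW he hz
  have hconst := const_of_unread I B hun
  rcases (sys I B).direction_collapse hinf (r := fun e => (sys I B).ρ e 0) (r' := fun e => (sys I B).ρ' e 0)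
      (fun e a => (hconst e a 0).1) (fun e a => (hconst e a 0).2) hK with ⟨mv, hmv⟩ | hU2
  · right
    by_cases hN : B.N = ∅
    · refine ⟨(1, 0), by decide, fun e he => ?_, fun e he => ?_⟩ <;> simp [hN] at he
    obtain ⟨e₁, he₁⟩ := nonempty_iff_ne_empty.2 hN
    have hm : mv ≠ 0 := by
      obtain ⟨a, -, -, -, hread⟩ := (sys I B).read_of_chordMinimal hinf he₁ (hmin e₁ he₁)
      intro h0
      rw [h0] at hmv
      unfold ChordSystem.Read at hread
      rw [(hconst e₁ a 0).1, (hconst e₁ a 0).2] at hread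
      rcases hread with h | h
      · exact h (by rcases (hmv e₁ he₁).1 with h' | h' <;> exact h')
      · exact h (by rcases (hmv e₁ he₁).2 with h' | h' <;> exact h')
    have hU1 : ∀ e a, ((sys I B).ρ e a = 0 ∨ (sys I B).ρ e a = mv) ∧ ((sys I B).ρ' e a = 0 ∨ (sys I B).ρ' e a = mv) := by
      intro e a
      by_cases he : e ∈ B.N
      · rw [(hconst e a 0).1, (hconst e a 0).2]; exact hmv e he
      · rw [(sys_ρ_of_not_mem I B he a).1, (sys_ρ_of_not_mem I B he a).2]; exact ⟨Or.inl rfl, Or.inl rfl⟩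
    exact ⟨mv, hm, hmv, fun e he => forced_chord_cases_dir I hI hS hB hW hr hm hU1 hconst hinf he (hmin e he)⟩
  · obtain ⟨e₀, he₀, h1, h2, h3, hrest⟩ := hU2
    refine Or.inl ⟨e₀, ?_, h1, h2, h3⟩
    exact eq_singleton_iff_unique_mem.2 ⟨he₀, fun e he => eq_of_U2 I hconst hinf hrest he (hmin e he)⟩

end Summit.PneNP.PneNP.Theorems.PstarChordBridgeBasis
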